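import Mathlib
import HarnessLib
import Summits.KontsevichZagierPeriods.Zeta5Search.CatalanTwoAdicPF

/-!
# CatalanTwoAdicPFPoly — the polynomials behind the partial fractions of the slid Catalan-ray forms

HONEST FRAMING: systematic search; no irrationality claim unless certified.  Pure algebra: polynomial identities
over `ℚ`; nothing here is an irrationality statement.

fam-catalan (pub-zeta5), Lean file #16 (with #17 `CatalanTwoAdicPFProof`).  The rational function of the slid
representation (`CatalanTwoAdicPF.Rn`, fam-denom CATK6 §1)
`R_n(T) = (½)_n · N(T) / (D₁(T) · D₂(T))`, `N(T) = ∏_{i<J+n}(T − J + ½ + i)`, `D₁(T) = ∏_{0≤i≤J}(T − J + n + i)`,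
`D₂(T) = ∏_{e<2n}(T + e + 1)`, has the nodes `c ∈ [0, J − n]` (simple), `−a`, `1 ≤ a ≤ n` (double) and `−a`,
`n < a ≤ 2n` (simple).  This file sets up the POLYNOMIAL side of the Hermite-interpolation proof of the partial-fraction
identity `PF n J`: the numerator `Npoly`, the full denominators `D1poly`/`D2poly` and the PUNCTURED denominators
`D1hat d`/`D2hat d`/`Dhat d` (the factor vanishing at `d` replaced by `1` — the polynomial counterpart of fam-denom's
`skip`), and proves: evaluation lemmas (`Dhat_eval_self : D̂_d(d) = D1(d)·D2(d)` with fam-denom's `D1`, `D2`;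
vanishing at the other nodes; `coef_mul_D1D2 : coef(d)·D1(d)D2(d) = K0·N(d)`), the factorizations
`(X − d)^{m_d} · D̂_d = D₁D₂`, the divisibility `(X + a)² ∣ D̂_d` (`d ≠ −a` a double node) and degree bounds (the
two logarithmic derivatives at a double node are in `CatalanTwoAdicPFProof`).  General lemmas first
(`derivative_prod_eval` = logarithmic derivative of a finite product, Hermite data at a double node
`sq_dvd_of_eval_of_derivative_eval`, punctured products `mul_prod_ite_eq_prod` …).
-/

namespace Summit.KontsevichZagierPeriods.Zeta5Search.CatalanTwoAdicSeries

open Finset Polynomial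
open Summit.KontsevichZagierPeriods.Zeta5Search.Denom.CatalanRayPClosed (K0 Nnum coef logDer D1 D2 skip)

/-! ### General polynomial lemmas (Hermite data at simple and double nodes) -/

/-- `((X − r)·q)′(r) = q(r)`. -/
theorem derivative_X_sub_C_mul_eval (r : ℚ) (q : ℚ[X]) :
    (((X - C r) * q).derivative).eval r = q.eval r := by
  simp [derivative_mul]

/-- a double root kills the derivative: `(X − r)² ∣ p ⇒ p′(r) = 0`. -/
theorem derivative_eval_eq_zero_of_sq_dvd (r : ℚ) {p : ℚ[X]} (h : (X - C r) ^ 2 ∣ p) :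
    p.derivative.eval r = 0 := by
  obtain ⟨q, rfl⟩ := h
  simp [derivative_mul, derivative_pow]

/-- Hermite data at a double node: `p(r) = 0 ∧ p′(r) = 0 ⇒ (X − r)² ∣ p`. -/
theorem sq_dvd_of_eval_of_derivative_eval (p : ℚ[X]) (r : ℚ) (h0 : p.eval r = 0)
    (h1 : p.derivative.eval r = 0) : (X - C r) ^ 2 ∣ p := by
  obtain ⟨q, rfl⟩ := (dvd_iff_isRoot.mpr h0 : (X - C r) ∣ p)
  have hq : q.eval r = 0 := by simpa [derivative_mul] using h1
  obtain ⟨u, rfl⟩ := (dvd_iff_isRoot.mpr hq : (X - C r) ∣ q)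
  exact ⟨u, by ring⟩

/-- logarithmic derivative of a finite product at a point where no factor vanishes:
`(∏ f)′(t) = (∏ f)(t) · Σ f_i′(t)/f_i(t)`. -/
theorem derivative_prod_eval {ι : Type*} [DecidableEq ι] (s : Finset ι) (f : ι → ℚ[X]) (t : ℚ)
    (h : ∀ i ∈ s, (f i).eval t ≠ 0) :
    (∏ i ∈ s, f i).derivative.eval t =
      (∏ i ∈ s, f i).eval t * ∑ i ∈ s, (f i).derivative.eval t / (f i).eval t := by
  rw [derivative_prod_finset, eval_finsetSum, eval_prod, Finset.mul_sum]
  refine sum_congr rfl fun i hi => ?_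
  rw [eval_mul, eval_prod, ← Finset.mul_prod_erase s (fun j => (f j).eval t) hi]
  field_simp [h i hi]

/-- a product of factors each equal to `1` or to a linear `X + C w` has `natDegree ≤` the number of linear ones;
crude form: `natDegree (∏_{i∈s} f i) ≤ #s` when every factor has `natDegree ≤ 1`. -/
theorem natDegree_prod_le_card_mem {ι : Type*} (s : Finset ι) (f : ι → ℚ[X])
    (h : ∀ i ∈ s, (f i).natDegree ≤ 1) : (∏ i ∈ s, f i).natDegree ≤ s.card := by
  calc (∏ i ∈ s, f i).natDegree ≤ ∑ i ∈ s, (f i).natDegree := natDegree_prod_le s f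
    _ ≤ ∑ _i ∈ s, 1 := sum_le_sum h
    _ = s.card := by simp

/-- same, with one factor known to be the constant `1`: `natDegree ≤ #s − 1`. -/
theorem natDegree_prod_le_card_sub_one {ι : Type*} [DecidableEq ι] (s : Finset ι) (f : ι → ℚ[X])
    (h : ∀ i ∈ s, (f i).natDegree ≤ 1) {i₀ : ι} (hi₀ : i₀ ∈ s) (h₀ : f i₀ = 1) :
    (∏ i ∈ s, f i).natDegree ≤ s.card - 1 := by
  rw [← Finset.mul_prod_erase s f hi₀, h₀, one_mul]
  calc (∏ i ∈ s.erase i₀, f i).natDegree ≤ (s.erase i₀).card :=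
        natDegree_prod_le_card_mem _ f fun i hi => h i (mem_of_mem_erase hi)
    _ = s.card - 1 := card_erase_of_mem hi₀

/-- the `ite`-factor used in the punctured denominators has `natDegree ≤ 1`. -/
theorem natDegree_ite_le (P : Prop) [Decidable P] (w : ℚ) :
    (if P then (1 : ℚ[X]) else X + C w).natDegree ≤ 1 := by
  split_ifs
  · simp
  · exact (natDegree_X_add_C w).le

/-- a punctured product times its missing factor is the full product: if exactly the index `i₀ ∈ s` has
`v i₀ = 0`, and the `i₀`-th linear factor is `X + C (w i₀)` with `w i₀ = -d`… stated abstractly: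
`(X + C (w i₀)) · ∏ (if v i = 0 then 1 else X + C (w i)) = ∏ (X + C (w i))`. -/
theorem mul_prod_ite_eq_prod {ι : Type*} [DecidableEq ι] (s : Finset ι) (v w : ι → ℚ) {i₀ : ι}
    (hi₀ : i₀ ∈ s) (hv : ∀ i ∈ s, v i = 0 ↔ i = i₀) :
    (X + C (w i₀)) * ∏ i ∈ s, (if v i = 0 then (1 : ℚ[X]) else X + C (w i)) = ∏ i ∈ s, (X + C (w i)) := by
  rw [← Finset.mul_prod_erase s _ hi₀, ← Finset.mul_prod_erase s (fun i => X + C (w i)) hi₀]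
  have h0 : v i₀ = 0 := (hv i₀ hi₀).mpr rfl
  rw [if_pos h0, one_mul]
  congr 1
  exact prod_congr rfl fun i hi => by
    rw [if_neg (fun h => (ne_of_mem_erase hi) ((hv i (mem_of_mem_erase hi)).mp h))]

/-- a punctured product with nothing punctured is the full product. -/
theorem prod_ite_eq_prod_of_forall_ne {ι : Type*} (s : Finset ι) (v w : ι → ℚ)
    (hv : ∀ i ∈ s, v i ≠ 0) :
    ∏ i ∈ s, (if v i = 0 then (1 : ℚ[X]) else X + C (w i)) = ∏ i ∈ s, (X + C (w i)) :=
  prod_congr rfl fun i hi => by rw [if_neg (hv i hi)]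

/-- a non-punctured linear factor divides the punctured product. -/
theorem X_add_C_dvd_prod_ite {ι : Type*} (s : Finset ι) (v w : ι → ℚ) {i₁ : ι} (hi₁ : i₁ ∈ s)
    (hv : v i₁ ≠ 0) :
    (X + C (w i₁)) ∣ ∏ i ∈ s, (if v i = 0 then (1 : ℚ[X]) else X + C (w i)) := by
  have h := Finset.dvd_prod_of_mem (fun i => if v i = 0 then (1 : ℚ[X]) else X + C (w i)) hi₁
  simpa [hv] using h

/-- evaluation of the punctured product at a point where a non-punctured factor vanishes. -/
theorem eval_prod_ite_eq_zero {ι : Type*} (s : Finset ι) (v w : ι → ℚ) (r : ℚ) {i₁ : ι} (hi₁ : i₁ ∈ s)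
    (hv : v i₁ ≠ 0) (hr : r + w i₁ = 0) :
    (∏ i ∈ s, (if v i = 0 then (1 : ℚ[X]) else X + C (w i))).eval r = 0 := by
  rw [eval_prod]
  exact prod_eq_zero hi₁ (by rw [if_neg hv]; simp [hr])

/-- evaluation of the punctured product at its own point `d` (where `v i = d + w i`): the `skip`-product. -/
theorem eval_prod_ite_self {ι : Type*} (s : Finset ι) (v w : ι → ℚ) (d : ℚ) (hvw : ∀ i ∈ s, v i = d + w i) :
    (∏ i ∈ s, (if v i = 0 then (1 : ℚ[X]) else X + C (w i))).eval d = ∏ i ∈ s, skip (v i) := by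
  rw [eval_prod]
  refine prod_congr rfl fun i hi => ?_
  unfold skip
  split_ifs with h
  · simp
  · simp [hvw i hi]

/-- the `skip`-product never vanishes. -/
theorem prod_skip_ne_zero {ι : Type*} (s : Finset ι) (v : ι → ℚ) : ∏ i ∈ s, skip (v i) ≠ 0 :=
  prod_ne_zero_iff.mpr fun i _ => by unfold skip; split_ifs with h <;> simp_all

/-- log-derivative data of the punctured product at its own point: every factor is non-zero there, and
`f_i′(d)/f_i(d) = (v i)⁻¹` (with `0⁻¹ = 0` at the punctured index). -/
theorem ite_derivative_div_eval {ι : Type*} (v w : ι → ℚ) (d : ℚ) (i : ι) (hvw : v i = d + w i) :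
    (if v i = 0 then (1 : ℚ[X]) else X + C (w i)).derivative.eval d /
        (if v i = 0 then (1 : ℚ[X]) else X + C (w i)).eval d = (v i)⁻¹ := by
  split_ifs with h
  · simp [h]
  · rw [hvw] at h ⊢; simp

/-- no `ite`-factor of a punctured product vanishes at its own point. -/
theorem ite_eval_ne_zero {ι : Type*} (v w : ι → ℚ) (d : ℚ) (i : ι) (hvw : v i = d + w i) :
    (if v i = 0 then (1 : ℚ[X]) else X + C (w i)).eval d ≠ 0 := by
  split_ifs with h
  · simp
  · rw [hvw] at h; simpa using h

/-! ### The polynomials behind `R_n`: numerator, full and punctured denominators -/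

/-- numerator polynomial `N(X) = ∏_{i<J+n} (X + (½ + i − J))` (`N(d) = Nnum n J d`). -/
noncomputable def Npoly (n J : ℕ) : ℚ[X] := ∏ i ∈ range (J + n), (X + C ((1 : ℚ) / 2 + i - J))

/-- full first denominator `∏_{i ≤ J} (X + (n + i − J))` (`= Dfull1 n J` on evaluation). -/
noncomputable def D1poly (n J : ℕ) : ℚ[X] := ∏ i ∈ range (J + 1), (X + C ((n : ℚ) + i - J))

/-- full second denominator `∏_{e < 2n} (X + (e + 1))` (`= Dfull2 n` on evaluation). -/
noncomputable def D2poly (n : ℕ) : ℚ[X] := ∏ e ∈ range (2 * n), (X + C ((e : ℚ) + 1))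

/-- punctured first denominator at `d`: the factor vanishing at `d` (if any) replaced by `1`. -/
noncomputable def D1hat (n J : ℕ) (d : ℚ) : ℚ[X] :=
  ∏ i ∈ range (J + 1), (if d - J + n + i = 0 then (1 : ℚ[X]) else X + C ((n : ℚ) + i - J))

/-- punctured second denominator at `d`. -/
noncomputable def D2hat (n : ℕ) (d : ℚ) : ℚ[X] :=
  ∏ e ∈ range (2 * n), (if d + e + 1 = 0 then (1 : ℚ[X]) else X + C ((e : ℚ) + 1))

/-- punctured denominator `D̂_d = D(X)/(X − d)^{m_d}`. -/
noncomputable def Dhat (n J : ℕ) (d : ℚ) : ℚ[X] := D1hat n J d * D2hat n d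

/-- `N(d) = Nnum n J d`. -/
theorem Npoly_eval (n J : ℕ) (d : ℚ) : (Npoly n J).eval d = Nnum n J d := by
  unfold Npoly Nnum; rw [eval_prod]; exact prod_congr rfl fun i _ => by simp; ring

/-- the full first denominator evaluates to `Dfull1`. -/
theorem D1poly_eval (n J : ℕ) (T : ℚ) : (D1poly n J).eval T = Dfull1 n J T := by
  unfold D1poly Dfull1; rw [eval_prod]; exact prod_congr rfl fun i _ => by simp; ring

/-- the full second denominator evaluates to `Dfull2`. -/
theorem D2poly_eval (n : ℕ) (T : ℚ) : (D2poly n).eval T = Dfull2 n T := by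
  unfold D2poly Dfull2; rw [eval_prod]; exact prod_congr rfl fun i _ => by simp; ring

/-- `D̂_d(d) = D1(d)·D2(d)` (fam-denom's `skip`-products). -/
theorem Dhat_eval_self (n J : ℕ) (d : ℚ) : (Dhat n J d).eval d = D1 n J d * D2 n d := by
  unfold Dhat D1 D2 D1hat D2hat
  rw [eval_mul, eval_prod_ite_self (range (J + 1)) (fun i : ℕ => d - J + n + i) (fun i : ℕ => (n : ℚ) + i - J) d
      (fun i _ => by ring), eval_prod_ite_self (range (2 * n)) (fun e : ℕ => d + e + 1) (fun e : ℕ => (e : ℚ) + 1) d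
      (fun e _ => by ring)]

/-- fam-denom's `skip`-products never vanish. -/
theorem D1_mul_D2_ne_zero (n J : ℕ) (d : ℚ) : D1 n J d * D2 n d ≠ 0 :=
  mul_ne_zero (prod_skip_ne_zero _ _) (prod_skip_ne_zero _ _)

/-- `coef(d) · D1(d)D2(d) = K0 · N(d)`. -/
theorem coef_mul_D1D2 (n J : ℕ) (d : ℚ) : coef n J d * (D1 n J d * D2 n d) = K0 n * Nnum n J d := by
  unfold coef; exact div_mul_cancel₀ _ (D1_mul_D2_ne_zero n J d)

/-! ### Factorizations `(X − d)^{m_d} · D̂_d = D` -/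

/-- if a factor of the first denominator vanishes at `d`, restoring it gives the full product. -/
theorem X_sub_C_mul_D1hat {n J : ℕ} {d : ℚ} (h : ∃ i₀, i₀ < J + 1 ∧ d - J + n + i₀ = 0) :
    (X - C d) * D1hat n J d = D1poly n J := by
  obtain ⟨i₀, hi₀, h0⟩ := h
  have hw : (n : ℚ) + i₀ - J = -d := by linarith
  have key := mul_prod_ite_eq_prod (range (J + 1)) (fun i : ℕ => d - J + n + i) (fun i : ℕ => (n : ℚ) + i - J)
    (mem_range.mpr hi₀) (fun i _ => ⟨fun h => by exact_mod_cast (by linarith : (i : ℚ) = i₀), fun h => by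
      subst h; exact h0⟩)
  rw [hw, C_neg, ← sub_eq_add_neg] at key
  exact key

/-- if no factor of the first denominator vanishes at `d`, nothing is punctured. -/
theorem D1hat_eq_D1poly {n J : ℕ} {d : ℚ} (h : ∀ i, i < J + 1 → d - J + n + i ≠ 0) :
    D1hat n J d = D1poly n J :=
  prod_ite_eq_prod_of_forall_ne (range (J + 1)) (fun i : ℕ => d - J + n + i) (fun i : ℕ => (n : ℚ) + i - J)
    fun i hi => h i (mem_range.mp hi)

/-- if a factor of the second denominator vanishes at `d`, restoring it gives the full product. -/
theorem X_sub_C_mul_D2hat {n : ℕ} {d : ℚ} (h : ∃ e₀, e₀ < 2 * n ∧ d + e₀ + 1 = 0) :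
    (X - C d) * D2hat n d = D2poly n := by
  obtain ⟨e₀, he₀, h0⟩ := h
  have hw : (e₀ : ℚ) + 1 = -d := by linarith
  have key := mul_prod_ite_eq_prod (range (2 * n)) (fun e : ℕ => d + e + 1) (fun e : ℕ => (e : ℚ) + 1)
    (mem_range.mpr he₀) (fun e _ => ⟨fun h => by exact_mod_cast (by linarith : (e : ℚ) = e₀), fun h => by
      subst h; exact h0⟩)
  rw [hw, C_neg, ← sub_eq_add_neg] at key
  exact key

/-- if no factor of the second denominator vanishes at `d`, nothing is punctured. -/
theorem D2hat_eq_D2poly {n : ℕ} {d : ℚ} (h : ∀ e, e < 2 * n → d + e + 1 ≠ 0) : D2hat n d = D2poly n :=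
  prod_ite_eq_prod_of_forall_ne (range (2 * n)) (fun e : ℕ => d + e + 1) (fun e : ℕ => (e : ℚ) + 1)
    fun e he => h e (mem_range.mp he)

/-! ### The three pole families: `c ∈ [0, J−n]` (simple), `−a`, `1 ≤ a ≤ n` (double), `−a`, `n < a ≤ 2n` (simple) -/

/-- pole data of the family `c ≥ 0`: the first denominator vanishes at index `J − n − c`, the second nowhere. -/
theorem poleC_D1 {n J c : ℕ} (hc : c + n ≤ J) : ∃ i₀, i₀ < J + 1 ∧ (c : ℚ) - J + n + i₀ = 0 :=
  ⟨J - (c + n), by omega, by push_cast [Nat.cast_sub hc]; ring⟩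

/-- … and the second denominator does not vanish at `c ≥ 0`. -/
theorem poleC_D2 (n c : ℕ) : ∀ e, e < 2 * n → (c : ℚ) + e + 1 ≠ 0 := fun e _ => by positivity

/-- pole data of the family `−a`, `1 ≤ a ≤ 2n`: the second denominator vanishes at index `a − 1`. -/
theorem poleA_D2 {n a : ℕ} (ha1 : 1 ≤ a) (ha2 : a ≤ 2 * n) : ∃ e₀, e₀ < 2 * n ∧ (-(a : ℚ)) + e₀ + 1 = 0 :=
  ⟨a - 1, by omega, by push_cast [Nat.cast_sub ha1]; ring⟩

/-- … and the first denominator vanishes at index `J − n + a` when `a ≤ n`, -/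
theorem poleA_D1_double {n J a : ℕ} (hJ : n ≤ J) (ha : a ≤ n) :
    ∃ i₀, i₀ < J + 1 ∧ (-(a : ℚ)) - J + n + i₀ = 0 :=
  ⟨J - n + a, by omega, by push_cast [Nat.cast_sub hJ]; ring⟩

/-- … and nowhere when `a > n`. -/
theorem poleA_D1_simple {n J a : ℕ} (ha : n < a) : ∀ i, i < J + 1 → (-(a : ℚ)) - J + n + i ≠ 0 := by
  intro i hi h
  have h' : ((n + i : ℕ) : ℚ) = ((a + J : ℕ) : ℚ) := by push_cast; linarith
  have := (Nat.cast_injective h' : n + i = a + J)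
  omega

/-! ### Evaluations of `D̂_d` at the OTHER poles vanish -/

/-- `D̂_d(c) = 0` for a node `c ∈ [0, J−n]`, `d ≠ c`. -/
theorem Dhat_eval_natCast_eq_zero {n J c : ℕ} (hc : c + n ≤ J) {d : ℚ} (hd : d ≠ c) :
    (Dhat n J d).eval (c : ℚ) = 0 := by
  unfold Dhat D1hat
  rw [eval_mul, eval_prod_ite_eq_zero (range (J + 1)) (fun i : ℕ => d - J + n + i)
    (fun i : ℕ => (n : ℚ) + i - J) (c : ℚ) (i₁ := J - (c + n)) (mem_range.mpr (by omega)) ?_ ?_, zero_mul]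
  · show d - J + n + ((J - (c + n) : ℕ) : ℚ) ≠ 0
    push_cast [Nat.cast_sub hc]
    intro h; exact hd (by linarith)
  · push_cast [Nat.cast_sub hc]; ring

/-- `D̂_d(−a) = 0` for a node `−a`, `1 ≤ a ≤ 2n`, `d ≠ −a`. -/
theorem Dhat_eval_neg_eq_zero {n J a : ℕ} (ha1 : 1 ≤ a) (ha2 : a ≤ 2 * n) {d : ℚ} (hd : d ≠ -(a : ℚ)) :
    (Dhat n J d).eval (-(a : ℚ)) = 0 := by
  unfold Dhat D2hat
  rw [eval_mul, eval_prod_ite_eq_zero (range (2 * n)) (fun e : ℕ => d + e + 1) (fun e : ℕ => (e : ℚ) + 1) (-(a : ℚ))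
    (i₁ := a - 1) (mem_range.mpr (by omega)) ?_ ?_, mul_zero]
  · show d + ((a - 1 : ℕ) : ℚ) + 1 ≠ 0
    push_cast [Nat.cast_sub ha1]
    intro h; exact hd (by linarith)
  · push_cast [Nat.cast_sub ha1]; ring

/-! ### Double nodes: `(X + a)² ∣ D̂_d` for `d ≠ −a`, `1 ≤ a ≤ n` -/

/-- `(X + a)² ∣ D̂_d` for a double node `−a` (`1 ≤ a ≤ n`) and `d ≠ −a`. -/
theorem sq_dvd_Dhat {n J a : ℕ} (hJ : n ≤ J) (ha1 : 1 ≤ a) (ha : a ≤ n) {d : ℚ} (hd : d ≠ -(a : ℚ)) :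
    (X - C (-(a : ℚ))) ^ 2 ∣ Dhat n J d := by
  have h1 : (X + C (a : ℚ)) ∣ D1hat n J d := by
    have key := X_add_C_dvd_prod_ite (range (J + 1)) (fun i : ℕ => d - J + n + i) (fun i : ℕ => (n : ℚ) + i - J)
      (i₁ := J - n + a) (mem_range.mpr (by omega)) (by
        show d - J + n + ((J - n + a : ℕ) : ℚ) ≠ 0
        push_cast [Nat.cast_sub hJ]; intro h; exact hd (by linarith))
    have hw : (n : ℚ) + ((J - n + a : ℕ) : ℚ) - J = a := by push_cast [Nat.cast_sub hJ]; ring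
    rw [hw] at key
    exact key
  have h2 : (X + C (a : ℚ)) ∣ D2hat n d := by
    have key := X_add_C_dvd_prod_ite (range (2 * n)) (fun e : ℕ => d + e + 1) (fun e : ℕ => (e : ℚ) + 1)
      (i₁ := a - 1) (mem_range.mpr (by omega)) (by
        show d + ((a - 1 : ℕ) : ℚ) + 1 ≠ 0
        push_cast [Nat.cast_sub ha1]; intro h; exact hd (by linarith))
    have hw : ((a - 1 : ℕ) : ℚ) + 1 = a := by push_cast [Nat.cast_sub ha1]; ring
    rw [hw] at key
    exact key
  rw [C_neg, sub_neg_eq_add, pow_two]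
  exact mul_dvd_mul h1 h2

/-! ### Degrees -/

/-- `deg N ≤ J + n`. -/
theorem natDegree_Npoly_le (n J : ℕ) : (Npoly n J).natDegree ≤ J + n := by
  unfold Npoly
  exact (natDegree_prod_le_card_mem (range (J + n)) (fun i : ℕ => X + C ((1 : ℚ) / 2 + i - J))
    (fun i _ => (natDegree_X_add_C _).le)).trans (by simp)

/-- `deg D̂₁ ≤ J + 1`. -/
theorem natDegree_D1hat_le (n J : ℕ) (d : ℚ) : (D1hat n J d).natDegree ≤ J + 1 := by
  unfold D1hat
  exact (natDegree_prod_le_card_mem (range (J + 1)) _ (fun i _ => natDegree_ite_le _ _)).trans (by simp)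

/-- `deg D̂₂ ≤ 2n`. -/
theorem natDegree_D2hat_le (n : ℕ) (d : ℚ) : (D2hat n d).natDegree ≤ 2 * n := by
  unfold D2hat
  exact (natDegree_prod_le_card_mem (range (2 * n)) _ (fun e _ => natDegree_ite_le _ _)).trans (by simp)

/-- `deg D̂₁ ≤ J` when a factor is punctured. -/
theorem natDegree_D1hat_le_of_root {n J : ℕ} {d : ℚ} (h : ∃ i₀, i₀ < J + 1 ∧ d - J + n + i₀ = 0) :
    (D1hat n J d).natDegree ≤ J := by
  obtain ⟨i₀, hi₀, h0⟩ := h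
  have := natDegree_prod_le_card_sub_one (range (J + 1))
    (fun i : ℕ => if d - J + n + i = 0 then (1 : ℚ[X]) else X + C ((n : ℚ) + i - J))
    (fun i _ => natDegree_ite_le _ _) (mem_range.mpr hi₀) (by simp [h0])
  unfold D1hat
  exact this.trans (by simp)

/-- `deg D̂₂ ≤ 2n − 1` when a factor is punctured. -/
theorem natDegree_D2hat_le_of_root {n : ℕ} {d : ℚ} (h : ∃ e₀, e₀ < 2 * n ∧ d + e₀ + 1 = 0) :
    (D2hat n d).natDegree ≤ 2 * n - 1 := by
  obtain ⟨e₀, he₀, h0⟩ := h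
  have := natDegree_prod_le_card_sub_one (range (2 * n))
    (fun e : ℕ => if d + e + 1 = 0 then (1 : ℚ[X]) else X + C ((e : ℚ) + 1))
    (fun e _ => natDegree_ite_le _ _) (mem_range.mpr he₀) (by simp [h0])
  unfold D2hat
  exact this.trans (by simp)

/-- `deg D̂_c ≤ J + 2n` at the nodes `c ≥ 0`. -/
theorem natDegree_Dhat_natCast_le {n J c : ℕ} (hc : c + n ≤ J) : (Dhat n J c).natDegree ≤ J + 2 * n := by
  unfold Dhat
  calc _ ≤ (D1hat n J c).natDegree + (D2hat n c).natDegree := natDegree_mul_le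
    _ ≤ J + 2 * n := Nat.add_le_add (natDegree_D1hat_le_of_root (poleC_D1 hc)) (natDegree_D2hat_le n c)

/-- `deg D̂_{−a} ≤ J + 2n` at the nodes `−a`, `1 ≤ a ≤ 2n`. -/
theorem natDegree_Dhat_neg_le {n J a : ℕ} (ha1 : 1 ≤ a) (ha2 : a ≤ 2 * n) :
    (Dhat n J (-(a : ℚ))).natDegree ≤ J + 2 * n := by
  unfold Dhat
  calc _ ≤ (D1hat n J (-(a : ℚ))).natDegree + (D2hat n (-(a : ℚ))).natDegree := natDegree_mul_le
    _ ≤ (J + 1) + (2 * n - 1) :=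
        Nat.add_le_add (natDegree_D1hat_le n J _) (natDegree_D2hat_le_of_root (poleA_D2 ha1 ha2))
    _ = J + 2 * n := by omega

/-- `deg D̂_{−a} ≤ J + 2n − 1` at the double nodes `−a`, `1 ≤ a ≤ n`. -/
theorem natDegree_Dhat_double_le {n J a : ℕ} (hJ : n ≤ J) (ha1 : 1 ≤ a) (ha : a ≤ n) :
    (Dhat n J (-(a : ℚ))).natDegree ≤ J + 2 * n - 1 := by
  unfold Dhat
  calc _ ≤ (D1hat n J (-(a : ℚ))).natDegree + (D2hat n (-(a : ℚ))).natDegree := natDegree_mul_le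
    _ ≤ J + (2 * n - 1) := Nat.add_le_add (natDegree_D1hat_le_of_root (poleA_D1_double hJ ha))
        (natDegree_D2hat_le_of_root (poleA_D2 ha1 (by omega)))
    _ = J + 2 * n - 1 := by omega

end Summit.KontsevichZagierPeriods.Zeta5Search.CatalanTwoAdicSeries
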